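import Summits.BirchSwinnertonDyer.BirchSwinnertonDyer.Theorems.PrintX11aUpperNonSurjFiveExcDivisibility
import Literature.NumberTheory.EllipticCurves.MazurTorsionGaloisStructureProofs
import Summits.BirchSwinnertonDyer.BirchSwinnertonDyer.Theorems.SignedLowerHalvesKobayashiLowerHalfSemistableAvatarObstruction
import Summits.BirchSwinnertonDyer.Rank1Residual.X9.PrintCertTamagawa
import Literature.NumberTheory.EllipticCurves.Rank1Residual.X11Three
import Literature.NumberTheory.EllipticCurves.ManinConstantQuadraticTwistClassCertificate
import Literature.NumberTheory.EllipticCurves.LevelLoweringGamma0GeneralFiveLe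
import HarnessLib

/-!
# Crux U5 `PrintX11a.UpperNonSurjFive` (item stmt-BirchSwinnertonDyer-20614), line «gl1cartan5», EXCEPTIONAL-ZERO road:
# ★ the EXCEPTIONAL-ZERO TAMAGAWA DIVISIBILITY and the EXC-SHALLOW SECTOR on class X11a — «`p` SPLIT multiplicative,
# `Ш(E)[p] = 0`, `ord_p ∏ c_ℓ ≤ 1` ⟹ `MissingUpperBoundAt`» — modulo named print facts, ONE of them NEW
# (`ribet1990_levelLowering_gamma0_newform_general_of_five_le`, Darmon–Diamond–Taylor Thm. 3.15 in `Γ₀`-newform currency at `p ≥ 5`, landed p685873)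

Cell `bsd-print-x11a`, seat `cruxlead-stmt-BirchSwinnertonDyer-20614` (LEAD g6); `--supports stmt-BirchSwinnertonDyer-20614`,
closes nothing. File 7 of the EXCEPTIONAL-ZERO road (lead g5's RECOMMENDED NEXT, executed). HONEST FRAMING: BSD is not proved by any of
this; nothing here bounds a non-trivial `Ш`; no statement of the summit is proved; every theorem below is CONDITIONAL on named
published facts taken BY NAME as hypotheses (`hCE` Coleman–Edixhoven 1998 Thm. 2.1, `hGV` Greenberg–Vatsal 2000 §3 (17)–(19), `hI` Ribet
1984 Thm. 4.1 (Ihara), `hMz` Mazur 1978 Cor. 4.1, `hnf` modularity, `hGZK` Gross–Zagier–Kolyvagin, and `hLL` = the ONE NEW FACT below).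

WHAT. On class X11a (`r_an = 0`, `p ∥ N`, `E[p]` irreducible, no (ram) prime: every multiplicative `ℓ ≠ p` has `p ∣ ord_ℓ Δ`) at a
NON-surjective `p ≥ 5` (so `p ∣ ord_p Δ`: `E[p]` is finite at `p`, `ClassX11a.dvd_padicValInt_self_of_not_surj`) which is SPLIT
multiplicative, BSD predicts `p ∣ c_p = ord_p Δ ∣ L(E,1)·#E(ℚ)²_tors/Ω_E`, i.e. `p ∣ L(E,1)/Ω_E`. THIS FILE proves it modulo the facts:
★ `one_le_padicValRat_LOne_div_of_classX11a_split` — «X11a ∧ ¬Surj ∧ 5 ≤ p ∧ p split ⟹ L(E,1)/Ω_E = t ∈ ℚ, t ≠ 0, 1 ≤ ord_p t».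
Mechanism (files `…Exc{Toolkit,ToolkitRoots,Core,CoreCycle,MultiStab,Period,PeriodCycle,Ihara,Divisibility}`): lower the level at
ALL the unramified multiplicative primes and at `p` (the new fact: a newform `g` of level `M₀ = N/(D·p)`, `D` = the product of the
multiplicative primes `≠ p`), re-stabilise `g` at the primes of `D` (signs `a_ℓ(E)`) and LAST at `p` with the ORDINARY root
`α ≡ a_p(E) = 1`, `β ≡ 0`: the level-`N` eigenform `h` is congruent to `f_E` at every `n`, and its plus symbol is `Φ − α⁻¹Φ(p·)`, whose
value at `{∞, 0}` is `(1 − α⁻¹)Φ(0) ≡ 0`; Vatsal's canonical-period congruence (Greenberg–Vatsal 2000 at `p ∥ N`) carries this to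
`[0]⁺_{f_E} = L(E,1)/Ω⁺_f`, Ihara's lemma guaranteeing that the comparison of periods does not degenerate, and Mazur's theorem
(`Ω_E = u·Ω⁺_f`, `|u|_p = 1`) to `L(E,1)/Ω_E`. Then the EXC-SHALLOW SECTOR of U5 (§4): with `Ш(E)[p] = 0` and `ord_p ∏c ≤ 1`
(at a split `p` on X11a this means `ord_p ∏c = ord_p c_p = 1` exactly), `ord_p #Ш_an = ord_p (L/Ω) − ord_p ∏c ≥ 0 = ord_p #Ш` and the
tree door `ClassX11a.missingUpperBoundAt_of_noPTorsion` gives `MissingUpperBoundAt W p`. Census (`CORES-CENSUS-cruxlead-g5.md`): 21 of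
the 23 open pairs at `N < 5·10⁵` are split-at-`5` of depth one (`#Ш_an ∈ {1,4}`); the two depth-two pairs (118080ds1, 346560lh1) and the
pairs with `Ш[p] ≠ 0` (none known) remain in the residual core C_exc♭.

THE NEW NAMED FACT (`Literature.NumberTheory.EllipticCurves.ribet1990_levelLowering_gamma0_newform_general_of_five_le`, module
`Literature/NumberTheory/EllipticCurves/LevelLoweringGamma0GeneralFiveLe.lean`, typed by this seat, p685873, reviewed): the `p ≥ 5` sibling of the tree's `ribet1990_levelLowering_gamma0_newform_at_three_general`
(module `LevelLoweringGamma0AtThreeGeneralLevel`, whose «`-- TODO(general form): every p ≥ 5`» it discharges), in the same `Γ₀`-newform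
/ `cuspCoeff` / `ι : ℚ̄_p ≃ ℂ` currency. Clause by clause (every locator in the HELD text of Darmon–Diamond–Taylor, *Fermat's Last Theorem*,
CDM 1995, `paper:doi-10-4310-cdm-1995-v1995-n1-a1`): for `E/ℚ` (globally minimal `W₀`, conductor `N = M₀·R`, `R` squarefree and prime to
`M₀`, `p² ∤ N`), `p ≥ 5`, `ρ̄ = E[p]` IRREDUCIBLE — hence absolutely irreducible, `p` odd (DDT p. 87) —: (1) the primes `r ∣ R` are
multiplicative with `p ∣ ord_r Δ_min`, i.e. `ρ̄` is unramified at `r ≠ p` (Prop. 2.12 (c)) and finite («good») at `r = p` (Prop. 2.12 (d),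
Lemma 2.22 (c)); the multiplicative primes `q ∤ R` have `p ∤ ord_q Δ_min`, i.e. `ρ̄` is ramified at `q ≠ p`, resp. not finite at `q = p`
(then `δ(ρ̄) = 1`: `ρ̄|I_p = (ω * ; 0 1)`, definition preceding Thm. 3.15); (2) at an ADDITIVE prime `q` of `E` (`q ≠ p` as `p² ∤ N`) the
exponent of `N(ρ̄)` is `f_q(E) − dim E[p]^{I_q}` (Lemma 2.7 with Remark 2.14) and `E[p]^{I_q} ⊂ E(ℚ_q^{nr})[p] = 0` because
`#Φ_q(𝔽̄_q) ≤ 4 < p` at an additive place and `E₀(ℚ_q^{nr})` has no `p`-torsion (Kodaira–Néron, Silverman ATAEC Cor. IV.9.2 (d) with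
Table 4.1; this is where `p ≥ 5` removes the sibling's clause «`3 ∤ #Φ_v`»); hence `N(ρ̄)·p^{δ(ρ̄)} = N/R = M₀` EXACTLY; (3) THEOREM 3.15
(`ℓ = p ≥ 5` odd, no proviso): a weight-two NEWFORM `g` with `ρ̄ ≅ ρ̄_g`, level `N_g = N(ρ̄)p^{δ(ρ̄)} = M₀` and character of order prime to `p`,
hence trivial (its reduction is `det ρ̄·ω⁻¹ = 1`): `g ∈ S₂(Γ₀(M₀))`; (4) the congruences modulo the prime of `ℚ̄ ⊂ ℂ` over `p` singled out by
`ι` (replace `g` by a conjugate): at `ℓ ∤ Np` both `a_ℓ` are `tr ρ̄(Frob_ℓ)` (Thm. 3.1 (a)); at a removed `r ≠ p`: `a_r(g) = tr ρ̄_g(Frob_r)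
≡ tr ρ̄_E(Frob_r) = a_r(E)(r + 1)` (Prop. 2.12 (b), unramified Tate curve); at the removed `r = p`: `ρ̄_g|G_p ≅ ρ̄_E|G_p` is ordinary
(Prop. 2.23) and `ρ_g|G_p` is good (Thm. 3.1 (f), `p ∤ N_g`), hence ordinary (Lemma 2.25 (b)) with unramified quotient `Frob_p ↦` the unit
root `≡ a_p(g)` (Thm. 3.1 (f)), while the unramified quotient of `ρ̄_E|G_p = (ωΨ * ; 0 1) ⊗ δ` is `δ`, `Frob_p ↦ a_p(E) = ±1` (Prop. 2.12
(b)) — the unramified rank-one quotient being unique as `ω|I_p ≠ 1` —, so `a_p(g) ≡ a_p(E) ≡ a_p(E)(p + 1)` (Deligne's theorem, Edixhoven 1992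
Thm. 2.5); at a kept multiplicative `q` (`q ∥ N_g`): `a_q(g) = ±1` is the Frobenius value on the unique unramified quotient line (Thm. 3.1
(e), resp. (g) at `q = p`; Carayol), equal to `a_q(E)`; at an additive `q` (`q² ∣ N_g`): `a_q(g) = 0 = a_q(E)` (Atkin–Lehner Thm. 3; tree
`IsNewform0.cuspCoeff_eq_zero_of_sq_dvd`). PRESEARCH (2026-08-29, corpus fts+vec+galaxy): Diamond–Taylor 1994 (non-optimal levels) and
Kraus 1997 (the conductor of `E[p]`) are NOT held and NOT needed for this optimal-level form; DDT Thm. 3.15 / §2–§3 held and read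
first-hand (pp. 54–58, 64–65, 85–87, 90–91); Ribet–Stein *Lectures on Serre's conjectures* Thm. 3.11/3.14 held (context); tree: the
`p = 3` siblings `ribet1990_levelLowering_gamma0_newform_at_three{,_general,_squarefree,…}`, `diamond1995_refinedSerre` (`Γ₁(N(ρ̄))`
currency, no local bookkeeping) — this file is not a restatement of either.

* §1 (pointer) the new fact, BY NAME.
* §2 `exists_multDecomposition` — `N = M₀·D·p` with `D` the squarefree product of the multiplicative primes `≠ p` (arithmetic).
* §3 ★ `one_le_padicValRat_LOne_div_of_classX11a_split` — the exceptional-zero Tamagawa divisibility on X11a, modulo `hCE hGV hI hMz hnf hLL`.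
* §4 ★ `missingUpperBoundAt_of_noPTorsion_of_excShallow`, `upperNonSurjFive_on_excShallowSector_of_facts` — the EXC-SHALLOW sector of U5.

## References

* H. Darmon, F. Diamond, R. Taylor, *Fermat's Last Theorem*, Current Developments in Mathematics 1995, 1–154: §2.1 p. 54, Lemma 2.7,
  Prop. 2.12, Remark 2.14, Lemma 2.22 (c), Prop. 2.23, Lemma 2.25 (b), Thm. 3.1 (a)(e)(f)(g), p. 87, Thm. 3.15 (pp. 90–91). [DarmonDiamondTaylor1995]
* K. A. Ribet, Invent. Math. 100 (1990) 431–476, Thm. 1.1 [Ribet1990]; F. Diamond, *The refined conjecture of Serre* (1995), Thm. 1.1,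
  Cor. 1.2 [Diamond1995RefinedSerre]; B. Edixhoven, Invent. Math. 109 (1992), Thms. 2.5–2.6 [Edixhoven1992]; H. Carayol, Ann. Sci. ÉNS 19
  (1986), Thm. (A) [Carayol1986]; A. O. L. Atkin, J. Lehner, Math. Ann. 185 (1970), Thm. 3 [AtkinLehner1970]; J. H. Silverman, *Advanced
  Topics* (1994), Cor. IV.9.2 (d), Table 4.1 [SilvermanATAEC1994]; J.-P. Serre, Invent. Math. 15 (1972), §2.4 Prop. 15 [Serre1972].
* V. Vatsal (1999) §1; R. Greenberg, V. Vatsal (2000) §3; K. A. Ribet, ICM 1983 Thm. 4.1; R. F. Coleman, B. Edixhoven (1998) Thm. 2.1;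
  B. Mazur (1978) Cor. 4.1; R. L. Miller, LMS J. Comput. Math. 14 (2011) Def. 1.1 [Miller2011LMS].
-/

set_option autoImplicit false
-- the Theorems namespace of a single-conjunct summit repeats the summit name by design (D-0017)
set_option linter.dupNamespace false

noncomputable section

open scoped MatrixGroups ModularForm Classical NNReal

open CongruenceSubgroup WeierstrassCurve IsDedekindDomain Literature.NumberTheory.EllipticCurves
  Literature.NumberTheory.EllipticCurves.ModularForms
  Literature.NumberTheory.EllipticCurves.Rank1Residual
  Literature.NumberTheory.EllipticCurves.Rank1Residual.Typed
  Literature.NumberTheory.EllipticCurves.Wuthrich2014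
  Summit.BirchSwinnertonDyer.Rank1Residual

namespace Summit.BirchSwinnertonDyer.BirchSwinnertonDyer.Theorems.GL1Cartan.Exc

/-! ### §1 The named fact (LANDED: `Literature/NumberTheory/EllipticCurves/LevelLoweringGamma0GeneralFiveLe.lean`, p685873) -/

-- `Literature.NumberTheory.EllipticCurves.ribet1990_levelLowering_gamma0_newform_general_of_five_le` is taken BY NAME below (binder `hLL`).

/-! ### §2 The multiplicative decomposition `N = M₀·D·p` of the conductor (arithmetic) -/

section Arith

/-- **`N_E = M₀·D·p` with `D` the (squarefree) product of the multiplicative primes `ℓ ≠ p`**, for `E` multiplicative at `p`: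
`p ∤ M₀D`, `D` prime to `M₀`, every prime of `D` is a multiplicative prime `≠ p`, and every multiplicative prime `≠ p` divides `D`
(a prime `ℓ` is multiplicative iff `ℓ ∥ N_E`: Silverman ATAEC IV.10.2). [cite: SilvermanATAEC1994, Thm. IV.10.2 (a)–(c)] -/
theorem exists_multDecomposition (W : WeierstrassCurve ℚ) [W.IsElliptic] [W.IsGloballyMinimal] (p : ℕ) [Fact p.Prime]
    (hmult : W.HasMultiplicativeReductionAtPrime p) :
    ∃ M₀ D : ℕ, M₀ ≠ 0 ∧ M₀ * D * p = W.conductorNorm ℤ ∧ ¬ p ∣ M₀ * D ∧ Squarefree D ∧ Nat.Coprime D M₀ ∧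
      (∀ (r : ℕ) (hr : r.Prime), r ∣ D → r ≠ p ∧ (haveI : Fact r.Prime := ⟨hr⟩; W.HasMultiplicativeReductionAtPrime r)) ∧
      (∀ (q : ℕ) (hq : q.Prime), (haveI : Fact q.Prime := ⟨hq⟩; W.HasMultiplicativeReductionAtPrime q) → q ≠ p → q ∣ D) := by
  classical
  have hp : p.Prime := Fact.out
  set N : ℕ := W.conductorNorm ℤ with hNdef
  have hN : N ≠ 0 := (W.conductorNorm_pos_holds).ne'
  have hpN : p ∣ N := X9.PrintCert.dvd_conductorNorm_of_not_hasGoodReductionAtPrime W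
    (Rank1Residual.not_hasGoodReductionAtPrime_of_hasMultiplicativeReductionAtPrime p hmult)
  have hp2 : ¬ p ^ 2 ∣ N :=
    Theorems.not_sq_dvd_conductorNorm_of_hasMultiplicativeReductionAtPrime W p hmult
  set S : Finset ℕ := N.primeFactors.filter (fun ℓ => ℓ ≠ p ∧ ¬ ℓ ^ 2 ∣ N) with hS
  set D : ℕ := ∏ ℓ ∈ S, ℓ with hD
  have hSmem : ∀ ℓ, ℓ ∈ S ↔ ℓ.Prime ∧ ℓ ∣ N ∧ ℓ ≠ p ∧ ¬ ℓ ^ 2 ∣ N := by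
    intro ℓ
    rw [hS, Finset.mem_filter, Nat.mem_primeFactors]
    tauto
  have hSprime : ∀ ℓ ∈ S, ℓ.Prime := fun ℓ h => ((hSmem ℓ).mp h).1
  have hdvdD : ∀ r : ℕ, r.Prime → r ∣ D → r ∈ S := by
    intro r hr hrD
    obtain ⟨ℓ, hℓS, hrℓ⟩ := (Prime.dvd_finsetProd_iff hr.prime (fun ℓ : ℕ => ℓ)).mp hrD
    have : r = ℓ := (Nat.prime_dvd_prime_iff_eq hr (hSprime ℓ hℓS)).mp hrℓ
    subst this; exact hℓS
  have hDp : D * p ∣ N := by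
    have h1 : (∏ ℓ ∈ insert p S, ℓ) ∣ N := by
      refine Finset.prod_primes_dvd N (fun ℓ hℓ => ?_) (fun ℓ hℓ => ?_)
      · rcases Finset.mem_insert.mp hℓ with rfl | h
        · exact hp.prime
        · exact (hSprime ℓ h).prime
      · rcases Finset.mem_insert.mp hℓ with rfl | h
        · exact hpN
        · exact ((hSmem ℓ).mp h).2.1
    have hpS : p ∉ S := fun h => ((hSmem p).mp h).2.2.1 rfl
    rw [Finset.prod_insert hpS] at h1
    rwa [mul_comm] at h1
  set M₀ := N / (D * p) with hM₀
  have hMDp : M₀ * (D * p) = N := Nat.div_mul_cancel hDp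
  have hM₀0 : M₀ ≠ 0 := by
    intro h0; rw [h0, zero_mul] at hMDp; exact hN hMDp.symm
  have hpD : ¬ p ∣ D := fun h => ((hSmem p).mp (hdvdD p hp h)).2.2.1 rfl
  have hpM₀ : ¬ p ∣ M₀ := by
    rintro ⟨k, hk⟩
    apply hp2
    refine ⟨k * D, ?_⟩
    rw [← hMDp, hk]; ring
  have hcop : Nat.Coprime D M₀ := by
    refine Nat.Coprime.prod_left fun ℓ hℓ => (Nat.Prime.coprime_iff_not_dvd (hSprime ℓ hℓ)).mpr ?_
    rintro ⟨k, hk⟩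
    apply ((hSmem ℓ).mp hℓ).2.2.2
    have hℓD : ℓ ∣ D := Finset.dvd_prod_of_mem _ hℓ
    obtain ⟨d, hd⟩ := hℓD
    refine ⟨k * d * p, ?_⟩
    rw [← hMDp, hk, hd]; ring
  have hsq : Squarefree D := by
    rw [Nat.squarefree_iff_prime_squarefree]
    intro q hq hqq
    have hqD : q ∣ D := dvd_trans (dvd_mul_right q q) hqq
    have hqS : q ∈ S := hdvdD q hq hqD
    have hsplit : D = q * ∏ ℓ ∈ S.erase q, ℓ := by
      rw [hD, ← Finset.mul_prod_erase S (fun ℓ : ℕ => ℓ) hqS]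
    rw [hsplit] at hqq
    have hq' : q ∣ ∏ ℓ ∈ S.erase q, ℓ := by
      obtain ⟨k, hk⟩ := hqq
      refine ⟨k, ?_⟩
      apply Nat.eq_of_mul_eq_mul_left hq.pos
      rw [hk]; ring
    obtain ⟨ℓ, hℓ, hqℓ⟩ := (Prime.dvd_finsetProd_iff hq.prime (fun ℓ : ℕ => ℓ)).mp hq'
    have hℓS : ℓ ∈ S := Finset.mem_of_mem_erase hℓ
    have : q = ℓ := (Nat.prime_dvd_prime_iff_eq hq (hSprime ℓ hℓS)).mp hqℓ
    subst this
    exact Finset.ne_of_mem_erase hℓ rfl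
  refine ⟨M₀, D, hM₀0, by rw [mul_assoc]; exact hMDp, ?_, hsq, hcop, fun r hr hrD => ?_, fun q hq hqm hqp => ?_⟩
  · intro h
    rcases (Nat.Prime.dvd_mul hp).mp h with h | h
    · exact hpM₀ h
    · exact hpD h
  · have h := (hSmem r).mp (hdvdD r hr hrD)
    haveI : Fact r.Prime := ⟨hr⟩
    refine ⟨h.2.2.1, ?_⟩
    rcases hasGoodReductionAtPrime_or_hasMultiplicativeReductionAtPrime_of_not_sq_dvd_conductorNorm (V := W) h.2.2.2 with hg | hm
    · exact absurd h.2.1 (not_dvd_conductorNorm_of_hasGoodReductionAtPrime W hg)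
    · exact hm
  · haveI : Fact q.Prime := ⟨hq⟩
    have hqN : q ∣ N := X9.PrintCert.dvd_conductorNorm_of_not_hasGoodReductionAtPrime W
      (Rank1Residual.not_hasGoodReductionAtPrime_of_hasMultiplicativeReductionAtPrime q hqm)
    have hq2 : ¬ q ^ 2 ∣ N :=
      Theorems.not_sq_dvd_conductorNorm_of_hasMultiplicativeReductionAtPrime W q hqm
    exact Finset.dvd_prod_of_mem (fun ℓ : ℕ => ℓ) ((hSmem q).mpr ⟨hq, hqN, hqp, hq2⟩)

end Arith

/-! ### §3 ★ The exceptional-zero Tamagawa divisibility on X11a -/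

section Divisibility

variable {W : WeierstrassCurve ℚ} [W.IsElliptic] [W.IsGloballyMinimal] {p : ℕ} [Fact p.Prime]

/-- ★ **THE EXCEPTIONAL-ZERO TAMAGAWA DIVISIBILITY on X11a (CONDITIONAL on six named facts, one of them new).** At an X11a pair `(W, p)`
with `ρ̄_{E,p}` NOT surjective, `5 ≤ p` and `p` SPLIT multiplicative: `L(E,1)/Ω_E = t` for a rational `t ≠ 0` with **`1 ≤ ord_p t`** —
i.e. `p ∣ L(E,1)/Ω_E`, as BSD predicts from `p ∣ c_p = ord_p Δ` (finite `E[p]` at the non-surjective `p`) and `p ∤ #E(ℚ)_tors`.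
Facts: `hCE` (Coleman–Edixhoven 1998 Thm. 2.1), `hGV` (Greenberg–Vatsal 2000 §3 (17)–(19)), `hI` (Ihara's lemma, Ribet 1984 Thm. 4.1),
`hMz` (Mazur 1978 Cor. 4.1), `hnf` (modularity), `hLL` (§1, Darmon–Diamond–Taylor Thm. 3.15 at `p ≥ 5`). Road: §2's decomposition
`N = M₀·D·p`; on X11a every prime of `D` is unramified (`¬ Ram`) and `p` is finite (`ClassX11a.dvd_padicValInt_self_of_not_surj`), no
multiplicative prime is kept, so `hLL` supplies the level-`M₀` newform; `…ExcDivisibility` does the rest.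
[cite: DarmonDiamondTaylor1995, Thm. 3.15 and Prop. 2.12] [cite: GreenbergVatsal2000, §3 (17)–(19), Remark 3.4] [cite: Vatsal1999, §1 (1.6), Thm. (1.13)]
[cite: Ribet1984ICM, Thm. 4.1] [cite: ColemanEdixhoven1998, Thm. 2.1] [cite: Mazur1978, Cor. 4.1] [cite: Serre1972, §2.4 Prop. 15] -/
theorem one_le_padicValRat_LOne_div_of_classX11a_split
    (hCE : colemanEdixhoven1998_heckePolynomial_simpleRoots)
    (hGV : greenbergVatsal2000_plusSymbol_congruence) (hI : ribet1984_iharaLemma)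
    (hMz : mazur_not_dvd_maninConstant_of_odd) (hnf : exists_isNewformOf) (hLL : ribet1990_levelLowering_gamma0_newform_general_of_five_le)
    (hX : ClassX11a W p) (hns : ¬ Surj W p) (hp5 : 5 ≤ p) (hsplit : W.HasSplitMultiplicativeReductionAtPrime p) :
    ∃ t : ℚ, W.entireLFunction 1 / (W.realPeriodRat : ℂ) = (t : ℂ) ∧ t ≠ 0 ∧ 1 ≤ padicValRat p t := by
  have hp : p.Prime := Fact.out
  obtain ⟨t, ht, ht0, -⟩ := hX.exists_LOne_div_realPeriod_eq_of_mazur hnf hMz hp5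
  refine ⟨t, ht, ht0, ?_⟩
  haveI : NeZero (W.conductorNorm ℤ) := ⟨(W.conductorNorm_pos_holds).ne'⟩
  obtain ⟨f, hf⟩ := hnf W
  have hmult : W.HasMultiplicativeReductionAtPrime p := hsplit.hasMultiplicativeReductionAtPrime
  obtain ⟨M₀, D, hM₀0, hMD, hpMD, hDsq, hDM₀, hDprimes, hmultD⟩ := exists_multDecomposition W p hmult
  haveI : NeZero M₀ := ⟨hM₀0⟩
  have hpD : ¬ p ∣ D := fun h => hpMD (h.mul_left M₀)
  have hpM₀ : ¬ p ∣ M₀ := fun h => hpMD (h.mul_right D)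
  -- the data of the fact at `R = D·p`
  have hMR : M₀ * (D * p) = W.conductorNorm ℤ := by rw [← mul_assoc]; exact hMD
  have hRsq : Squarefree (D * p) :=
    (Nat.squarefree_mul ((Nat.Prime.coprime_iff_not_dvd hp).mpr hpD).symm).mpr ⟨hDsq, hp.prime.squarefree⟩
  have hRcop : Nat.Coprime (D * p) M₀ := Nat.Coprime.mul_left hDM₀ ((Nat.Prime.coprime_iff_not_dvd hp).mpr hpM₀)
  have hp2N : ¬ p ^ 2 ∣ W.conductorNorm ℤ :=
    Theorems.not_sq_dvd_conductorNorm_of_hasMultiplicativeReductionAtPrime W p hmult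
  have hR : ∀ (r : ℕ) (hr : r.Prime), r ∣ D * p →
      (haveI : Fact r.Prime := ⟨hr⟩; W.HasMultiplicativeReductionAtPrime r) ∧ p ∣ padicValInt r W.minimalDiscriminantInt := by
    intro r hr hrDp
    by_cases hrp : r = p
    · subst hrp
      exact ⟨hmult, hX.dvd_padicValInt_self_of_not_surj hns⟩
    · have hrD : r ∣ D := by
        rcases (Nat.Prime.dvd_mul hr).mp hrDp with h | h
        · exact h
        · exact absurd ((Nat.prime_dvd_prime_iff_eq hr hp).mp h) hrp
      obtain ⟨-, hmr⟩ := hDprimes r hr hrD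
      haveI : Fact r.Prime := ⟨hr⟩
      refine ⟨hmr, ?_⟩
      -- `¬ Ram`: every multiplicative `r ≠ p` has `p ∣ ord_r Δ_min`
      by_contra hnd
      exact hX.2.2.2.2 ⟨r, ⟨hr⟩, hrp, hmr, hnd⟩
  have hK : ∀ (q : ℕ) (hq : q.Prime), (haveI : Fact q.Prime := ⟨hq⟩; W.HasMultiplicativeReductionAtPrime q) → ¬ q ∣ D * p →
      ¬ p ∣ padicValInt q W.minimalDiscriminantInt := by
    intro q hq hqm hqR
    exfalso
    by_cases hqp : q = p
    · subst hqp; exact hqR (dvd_mul_left q D)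
    · exact hqR ((hmultD q hq hqm hqp).mul_right p)
  have hex : ∀ ι : PadicAlgCl p ≃+* ℂ, ∃ g : CuspForm (Gamma0 M₀) 2, IsNewform0 g ∧
      (∀ ℓ : ℕ, ℓ.Prime → ¬ ℓ ∣ D * p → Valued.v (ι.symm (cuspCoeff f ℓ - cuspCoeff g ℓ)) < 1) ∧
      (∀ ℓ : ℕ, ℓ.Prime → ℓ ∣ D * p → Valued.v (ι.symm (cuspCoeff g ℓ - cuspCoeff f ℓ * (ℓ + 1))) < 1) :=
    fun ι => hLL W p hp5 hX.irr hMR hRsq hRcop hp2N rfl hR hK f hf ι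
  -- the signs `a_ℓ(f) = ±1` on `D` (multiplicative primes)
  have hsign : ∀ ℓ : ℕ, ℓ.Prime → ℓ ∣ D → ∃ u : ℤ, u * u = 1 ∧ cuspCoeff f ℓ = u := by
    intro ℓ hℓ hℓD
    haveI : Fact ℓ.Prime := ⟨hℓ⟩
    obtain ⟨-, hmℓ⟩ := hDprimes ℓ hℓ hℓD
    refine ⟨W.LFunction ℓ, ?_, hf.2 ℓ⟩
    have hsq := (LFunction_prime_pow_of_hasMultiplicativeReductionAtPrime W ℓ hmℓ 0).2
    rw [pow_two] at hsq
    exact hsq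
  exact one_le_padicValRat_LOne_div_realPeriod_of_exists_levelLoweredNewform hCE hGV hI hMz W hp5 hsplit hX.irr rfl hf hMD hpMD
    hDsq hDM₀ hsign hex t ht ht0

end Divisibility

/-! ### §4 ★ The EXC-SHALLOW sector of U5: split `p`, `Ш(E)[p] = 0`, `ord_p ∏c ≤ 1` -/

section Sector

variable {W : WeierstrassCurve ℚ} [W.IsElliptic] [W.IsGloballyMinimal] {p : ℕ} [Fact p.Prime]

/-- **BSD-quotient bookkeeping**: if `L(E,1)/Ω_E = t ≠ 0` with `1 ≤ ord_p t`, `E[p]` is irreducible (so `p ∤ #E(ℚ)`) and `ord_p ∏c ≤ 1`, then the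
analytic order `#Ш_an = t·#E(ℚ)²/∏c` (Gross–Zagier–Kolyvagin, `r_an = 0`, `hGZK`) is a rational of valuation `≥ 0`. [cite: Miller2011LMS, Def. 1.1 (arXiv:1010.2431 p. 3)]
[cite: SilvermanATAEC1994, Cor. IV.9.2 (d)] -/
theorem exists_shaAn_eq_padicValRat_nonneg_of_one_le (hGZK : rank_eq_analyticRank_of_analyticRank_le_one)
    (hirr : W.HasIrreducibleModPGaloisRep p) {t : ℚ} (ht : W.entireLFunction 1 / (W.realPeriodRat : ℂ) = (t : ℂ)) (ht0 : t ≠ 0)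
    (h1 : 1 ≤ padicValRat p t) (htam : padicValNat p W.tamagawaProduct ≤ 1) :
    ∃ q : ℚ, shaAn W = (q : ℂ) ∧ 0 ≤ padicValRat p q := by
  have hL1 : W.entireLFunction 1 ≠ 0 := by
    intro h0
    apply ht0
    have h : ((t : ℚ) : ℂ) = 0 := by rw [← ht, h0, zero_div]
    exact_mod_cast h
  obtain ⟨-, hE, -, hsha⟩ := shaAn_eq_of_L_one_div_eq hGZK W hL1 ht
  haveI := hE
  refine ⟨_, hsha, ?_⟩
  -- `p ∤ #E(ℚ)`: irreducible `E[p]` (Cauchy + Mazur III §5)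
  have hcardE : ¬ p ∣ Nat.card W.toAffine.Point := fun hdvd =>
    not_exists_addOrderOf_eq_of_hasIrreducibleModPGaloisRep W hirr
      (exists_prime_addOrderOf_dvd_card' (G := W.toAffine.Point) p hdvd)
  have hcard0 : (Nat.card W.toAffine.Point : ℚ) ≠ 0 := by
    exact_mod_cast (Nat.card_pos (α := W.toAffine.Point)).ne'
  have htam0 : (W.tamagawaProduct : ℚ) ≠ 0 := by
    exact_mod_cast (W.tamagawaProduct_pos_holds : 0 < W.tamagawaProduct).ne'
  have hcardv : padicValRat p (Nat.card W.toAffine.Point : ℚ) = 0 := by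
    rw [padicValRat.of_nat, padicValNat.eq_zero_of_not_dvd hcardE, Nat.cast_zero]
  rw [padicValRat.div (mul_ne_zero ht0 (pow_ne_zero 2 hcard0)) htam0,
    padicValRat.mul ht0 (pow_ne_zero 2 hcard0), padicValRat.pow, hcardv, padicValRat.of_nat]
  have h2 : (padicValNat p W.tamagawaProduct : ℤ) ≤ 1 := by exact_mod_cast htam
  linarith

/-- ★ **The EXC-SHALLOW sector (CONDITIONAL on seven named facts): «X11a, `¬ Surj`, `5 ≤ p`, `p` SPLIT multiplicative, `ord_p ∏ c_ℓ ≤ 1`,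
`Ш(E)[p] = 0` ⟹ `MissingUpperBoundAt W p`».** `#Ш_an = (L/Ω)·#E(ℚ)²/∏c` (GZK, `r_an = 0`), so `ord_p #Ш_an = ord_p (L/Ω) − ord_p ∏c ≥
1 − 1 = 0 = ord_p #Ш` by §3, and the tree door `ClassX11a.missingUpperBoundAt_of_noPTorsion` concludes. (At a split `p` on X11a
`ord_p ∏c ≥ ord_p c_p ≥ 1`, so the shallow hypothesis means depth EXACTLY one; the depth-`≥ 2` pairs and the pairs with `Ш[p] ≠ 0` form
the residual core C_exc♭.) [cite: Miller2011LMS, Def. 1.1 (arXiv:1010.2431 p. 3)] [cite: SilvermanATAEC1994, Cor. IV.9.2 (d) and Table 4.1]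
[cite: DarmonDiamondTaylor1995, Thm. 3.15] [cite: GreenbergVatsal2000, §3 (17)–(19)] -/
theorem missingUpperBoundAt_of_noPTorsion_of_excShallow
    (hCE : colemanEdixhoven1998_heckePolynomial_simpleRoots)
    (hGV : greenbergVatsal2000_plusSymbol_congruence) (hI : ribet1984_iharaLemma)
    (hMz : mazur_not_dvd_maninConstant_of_odd) (hnf : exists_isNewformOf) (hLL : ribet1990_levelLowering_gamma0_newform_general_of_five_le)
    (hGZK : rank_eq_analyticRank_of_analyticRank_le_one)
    (hX : ClassX11a W p) (hns : ¬ Surj W p) (hp5 : 5 ≤ p) (hsplit : W.HasSplitMultiplicativeReductionAtPrime p)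
    (htam : padicValNat p W.tamagawaProduct ≤ 1) (hSha : ∀ x : W.sha, (p : ℤ) • x = 0 → x = 0) :
    MissingUpperBoundAt W p := by
  obtain ⟨t, ht, ht0, h1⟩ := one_le_padicValRat_LOne_div_of_classX11a_split hCE hGV hI hMz hnf hLL hX hns hp5 hsplit
  obtain ⟨q, hq, hv⟩ := exists_shaAn_eq_padicValRat_nonneg_of_one_le hGZK hX.irr ht ht0 h1 htam
  exact hX.missingUpperBoundAt_of_noPTorsion hGZK hq hv hSha

/-- ★ **The EXC-SHALLOW sector, class-wide form (CONDITIONAL on the seven facts)** — the registered-stub shape for the line's skeleton.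
[cite: Miller2011LMS, Def. 1.1 (arXiv:1010.2431 p. 3)] [cite: DarmonDiamondTaylor1995, Thm. 3.15] -/
theorem upperNonSurjFive_on_excShallowSector_of_facts
    (hCE : colemanEdixhoven1998_heckePolynomial_simpleRoots)
    (hGV : greenbergVatsal2000_plusSymbol_congruence) (hI : ribet1984_iharaLemma)
    (hMz : mazur_not_dvd_maninConstant_of_odd) (hnf : exists_isNewformOf) (hLL : ribet1990_levelLowering_gamma0_newform_general_of_five_le)
    (hGZK : rank_eq_analyticRank_of_analyticRank_le_one) :
    ∀ (W : WeierstrassCurve ℚ) [W.IsElliptic] [W.IsGloballyMinimal] (p : ℕ) [Fact p.Prime],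
      ClassX11a W p → ¬ Surj W p → 5 ≤ p → W.HasSplitMultiplicativeReductionAtPrime p →
      padicValNat p W.tamagawaProduct ≤ 1 → (∀ x : W.sha, (p : ℤ) • x = 0 → x = 0) → MissingUpperBoundAt W p :=
  fun _ _ _ _ _ hX hns hp5 hsplit htam hSha =>
    missingUpperBoundAt_of_noPTorsion_of_excShallow hCE hGV hI hMz hnf hLL hGZK hX hns hp5 hsplit htam hSha

end Sector

end Summit.BirchSwinnertonDyer.BirchSwinnertonDyer.Theorems.GL1Cartan.Exc

end
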